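import Summits.ValiantsHypothesis.ValiantsHypothesis.Theorems.BarrierLeverAnchoredDoorHitsLowerPairsStarSpec

/-!
# Support item `AnchoredDoorHitsLowerPairs` (stmt-ValiantsHypothesis-22510), line `anchored-peeling`:
# BRICK DEGENERATION — every brick certificate with distinct anchor representatives is a certificate for the symbolic door

Helper file (`--supports stmt-ValiantsHypothesis-22510`; cell valiant-natproofs, rung V4, 𝒟-side door (c); prover seat val-np-p1 gen 15;
companion memo HOME/val-np-p1/g15/STARSTEP-RIGID-MEMO-valnp1-g15.md §2.3). Closes NO item.

THE STATEMENT (`symbolicDet_ne_zero_of_brickDegeneration`). Let `U ⊆ anchors s h` and, for every used anchor `α = (A | B) ∈ U`, a brick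
`(Zb α | Wb α)` with `A ⊆ Zb α`, `B ⊆ Wb α` (so the bricks have DISTINCT anchor representatives). If the layout matrix of the plain brick
product `∏_{α ∈ U} (1 + x^{Zb α} y^{Wb α})` on `(u, w)` has nonzero determinant, then `symbolicDet s h r u w ≠ 0`.

WHY (a lowest-order degeneration, one variable `λ`). Specialise (`degSpec`) `θ_α ↦ λ^{|Zb α| + |Wb α|}` for `α ∈ U` and `θ_α ↦ 0` otherwise, the
twists of `α` INSIDE its brick to `1`, all other twists to `0`. The factor of `α` becomes
`1 + λ^{|A|+|B|} x^A y^B · ∏_{b ∈ Zb∖A} (λ + λ x_b) · ∏_{e ∈ Wb∖B} (λ + λ y_e)`, a polynomial all of whose coefficients `[x^S y^T]` are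
`O(λ^{|S|+|T|})` with `λ^{|S|+|T|}`-coefficient equal to the corresponding coefficient of the FULL brick `1 + x^{Zb} y^{Wb}` (`LowPart`, stable
under sums and products: `LowPart.add`, `LowPart.mul`, `LowPart.prod`). Hence the specialised layout matrix is
`diag(λ^{|u i|}) · (B + λ·…) · diag(λ^{|w j|})` with `B` the brick layout, and `det B ≠ 0` forces the specialised — hence the symbolic —
determinant to be nonzero (`Matrix.det_mul_row/column`, `Polynomial.constantCoeff` through `RingHom.map_det`).

USE. With `s = 1` (vertex–vertex anchors only) this shows that the SMALLEST anchored door 𝔄₁ inherits every brick certificate whose bricks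
admit a system of distinct representatives `(a_i ∈ Z_i, d_i ∈ W_i)` — e.g. the landed cube-versus-Hamming-ball witness of `…CubeBall`
(bricks `(a|a)` and `(x_{2j}x_{2j+1} | d)`, representatives `(a,a)` and `(2j, d)`), in line with the census of the memo (𝔄₁ hits every
structured star-step-free pair tested, h ≤ 13). The Reed–Solomon no-go (`not_exactCoverHypothesis`) says such certificates (≤ h² bricks)
cannot reach all lower pairs, so this is a tool, not a route.

WHAT THIS IS NOT: nothing on `stub_rigidPairs` in general, on items 22510 / 19717 themselves, on crux stmt-ValiantsHypothesis-14610, or on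
`VP` versus `VNP`.
-/

set_option linter.dupNamespace false

namespace Summit.ValiantsHypothesis.ValiantsHypothesis.Theorems.BarrierLever.AnchoredPeeling

open Finset MvPolynomial
open Summit.ValiantsHypothesis.ValiantsHypothesis.Theorems.BarrierLever.BrickCalculus (pexpo pexpo_def pexpo_le_iff pexpo_sub)

noncomputable section

variable {h : ℕ}

/-! ## 1. Lowest-order parts: `LowPart g b` -/

/-- `LowPart g b`: for every monomial `m`, the coefficient `[m] g ∈ ℂ[λ]` vanishes below degree `deg m` and its `λ^{deg m}`-coefficient is
`[m] b`. ("`g = b(λx, λy) + higher order in λ`".) -/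
def LowPart (g : MvPolynomial (Fin (h + h)) (Polynomial ℂ)) (b : MvPolynomial (Fin (h + h)) ℂ) : Prop :=
  ∀ m : Fin (h + h) →₀ ℕ, (∀ k, k < Finsupp.degree m → (coeff m g).coeff k = 0) ∧
    (coeff m g).coeff (Finsupp.degree m) = coeff m b

namespace LowPart

/-- Constants. -/
theorem C (c : ℂ) : LowPart (h := h) (MvPolynomial.C (Polynomial.C c)) (MvPolynomial.C c) := by
  classical
  intro m
  by_cases hm : m = 0
  · subst hm
    simp only [coeff_C, if_true, map_zero, Polynomial.coeff_C_zero]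
    exact ⟨fun k hk => absurd hk (Nat.not_lt_zero k), trivial⟩
  · have h0 : ¬ (0 : Fin (h + h) →₀ ℕ) = m := fun h' => hm h'.symm
    simp only [coeff_C, if_neg h0, Polynomial.coeff_zero]
    exact ⟨fun _ _ => trivial, trivial⟩

/-- One. -/
theorem one : LowPart (h := h) 1 1 := by
  have := LowPart.C (h := h) 1
  simpa only [map_one] using this

/-- Sums. -/
theorem add {g₁ g₂ : MvPolynomial (Fin (h + h)) (Polynomial ℂ)} {b₁ b₂ : MvPolynomial (Fin (h + h)) ℂ}
    (h₁ : LowPart g₁ b₁) (h₂ : LowPart g₂ b₂) : LowPart (g₁ + g₂) (b₁ + b₂) := by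
  intro m
  obtain ⟨l₁, e₁⟩ := h₁ m
  obtain ⟨l₂, e₂⟩ := h₂ m
  refine ⟨fun k hk => ?_, ?_⟩
  · rw [coeff_add, Polynomial.coeff_add, l₁ k hk, l₂ k hk, add_zero]
  · rw [coeff_add, Polynomial.coeff_add, e₁, e₂, coeff_add]

/-- Products (the degree of monomials is additive). -/
theorem mul {g₁ g₂ : MvPolynomial (Fin (h + h)) (Polynomial ℂ)} {b₁ b₂ : MvPolynomial (Fin (h + h)) ℂ}
    (h₁ : LowPart g₁ b₁) (h₂ : LowPart g₂ b₂) : LowPart (g₁ * g₂) (b₁ * b₂) := by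
  classical
  intro m
  -- coefficient `k` of `[m](g₁ g₂)` as a double sum
  have key : ∀ k, k ≤ Finsupp.degree m → (coeff m (g₁ * g₂)).coeff k =
      if k = Finsupp.degree m then coeff m (b₁ * b₂) else 0 := by
    intro k hk
    rw [coeff_mul, coeff_mul, Polynomial.finsetSum_coeff]
    by_cases hkeq : k = Finsupp.degree m
    · rw [if_pos hkeq]
      refine Finset.sum_congr rfl (fun x hx => ?_)
      have hx' : Finsupp.degree x.1 + Finsupp.degree x.2 = Finsupp.degree m := by
        rw [← map_add, (Finset.HasAntidiagonal.mem_antidiagonal.mp hx)]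
      rw [Polynomial.coeff_mul, Finset.sum_eq_single (Finsupp.degree x.1, Finsupp.degree x.2)]
      · rw [(h₁ x.1).2, (h₂ x.2).2]
      · rintro ⟨i, j⟩ hij hne
        have hij' : i + j = k := Finset.HasAntidiagonal.mem_antidiagonal.mp hij
        by_cases hi : i < Finsupp.degree x.1
        · rw [(h₁ x.1).1 i hi, zero_mul]
        · have hj : j < Finsupp.degree x.2 := by
            by_contra hj
            have hi' : i = Finsupp.degree x.1 := by
              by_contra hi'
              have : Finsupp.degree x.1 < i := lt_of_le_of_ne (not_lt.mp hi) (Ne.symm hi')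
              omega
            have hj' : j = Finsupp.degree x.2 := by omega
            exact hne (Prod.ext hi' hj')
          rw [(h₂ x.2).1 j hj, mul_zero]
      · intro hnot
        exact absurd (Finset.HasAntidiagonal.mem_antidiagonal.mpr (by rw [hx', hkeq])) hnot
    · rw [if_neg hkeq]
      refine Finset.sum_eq_zero (fun x hx => ?_)
      have hx' : Finsupp.degree x.1 + Finsupp.degree x.2 = Finsupp.degree m := by
        rw [← map_add, (Finset.HasAntidiagonal.mem_antidiagonal.mp hx)]
      rw [Polynomial.coeff_mul]
      refine Finset.sum_eq_zero (fun ij hij => ?_)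
      have hij' : ij.1 + ij.2 = k := Finset.HasAntidiagonal.mem_antidiagonal.mp hij
      by_cases hi : ij.1 < Finsupp.degree x.1
      · rw [(h₁ x.1).1 ij.1 hi, zero_mul]
      · have hj : ij.2 < Finsupp.degree x.2 := by
          have : k < Finsupp.degree m := lt_of_le_of_ne hk hkeq
          omega
        rw [(h₂ x.2).1 ij.2 hj, mul_zero]
  refine ⟨fun k hk => ?_, ?_⟩
  · rw [key k hk.le, if_neg (ne_of_lt hk)]
  · rw [key _ le_rfl, if_pos rfl]

/-- Finite products. -/
theorem prod {ι : Type*} (s : Finset ι) {g : ι → MvPolynomial (Fin (h + h)) (Polynomial ℂ)}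
    {b : ι → MvPolynomial (Fin (h + h)) ℂ} (hg : ∀ i ∈ s, LowPart (g i) (b i)) :
    LowPart (∏ i ∈ s, g i) (∏ i ∈ s, b i) := by
  classical
  induction s using Finset.induction_on with
  | empty => simpa using LowPart.one (h := h)
  | insert a s ha ih =>
    rw [Finset.prod_insert ha, Finset.prod_insert ha]
    exact LowPart.mul (hg a (Finset.mem_insert_self a s)) (ih fun i hi => hg i (Finset.mem_insert_of_mem hi))

/-- A monomial carrying exactly `λ^{deg}`. -/
theorem monomial (m : Fin (h + h) →₀ ℕ) :
    LowPart (MvPolynomial.C (Polynomial.X ^ Finsupp.degree m) * MvPolynomial.monomial m 1) (MvPolynomial.monomial m 1) := by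
  classical
  intro m'
  rw [coeff_C_mul, coeff_monomial, coeff_monomial]
  by_cases hm : m = m'
  · subst hm
    refine ⟨fun k hk => ?_, ?_⟩
    · simp only [↓reduceIte, mul_one, Polynomial.coeff_X_pow, if_neg (ne_of_lt hk)]
    · simp only [↓reduceIte, mul_one, Polynomial.coeff_X_pow]
  · simp only [if_neg hm, mul_zero, Polynomial.coeff_zero]
    exact ⟨fun _ _ => trivial, trivial⟩

/-- The scaled unit twist `λ + λ·X_v = λ(1 + X_v)` has lowest-order part `X_v`. -/
theorem lin (v : Fin (h + h)) :
    LowPart (MvPolynomial.C Polynomial.X + MvPolynomial.C Polynomial.X * X v) (X v) := by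
  classical
  intro m'
  rw [coeff_add, coeff_C, coeff_C_mul, coeff_X, coeff_X]
  by_cases h0 : (0 : Fin (h + h) →₀ ℕ) = m'
  · subst h0
    have hne : ¬ Finsupp.single v 1 = (0 : Fin (h + h) →₀ ℕ) := by
      intro h'; have := Finsupp.single_eq_zero.mp h'; exact one_ne_zero this
    simp only [if_true, if_neg hne, mul_zero, add_zero, map_zero, Polynomial.coeff_X_zero]
    exact ⟨fun k hk => absurd hk (Nat.not_lt_zero k), trivial⟩
  · by_cases h1 : Finsupp.single v 1 = m'
    · subst h1
      simp only [if_neg h0, if_true, zero_add, mul_one, Finsupp.degree_single, Polynomial.coeff_X_one]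
      refine ⟨fun k hk => ?_, trivial⟩
      have hk0 : k = 0 := by omega
      subst hk0
      exact Polynomial.coeff_X_zero
    · simp only [if_neg h0, if_neg h1, mul_zero, add_zero, Polynomial.coeff_zero]
      exact ⟨fun _ _ => trivial, trivial⟩

end LowPart

/-! ## 2. The degeneration map -/

/-- Degree of a square-free exponent: `deg (x^U y^W) = |U| + |W|`. -/
theorem degree_pexpo (U W : Finset (Fin h)) : Finsupp.degree (pexpo U W) = U.card + W.card := by
  rw [pexpo_def, map_add, map_sum, map_sum]
  simp only [Finsupp.degree_single, Finset.sum_const, smul_eq_mul, mul_one]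

/-- The degeneration of the parameters attached to a brick list with distinct anchor representatives:
`θ_α ↦ λ^{|Zb α|+|Wb α|}` (`α ∈ U`), `θ_α ↦ 0` (`α ∉ U`); twists of `α ∈ U` inside its brick `↦ 1`, every other twist `↦ 0`. -/
def degSpec (U : Finset (Finset (Fin h) × Finset (Fin h))) (Zb Wb : Finset (Fin h) × Finset (Fin h) → Finset (Fin h)) :
    Param h → Polynomial ℂ
  | Sum.inl α => if α ∈ U then Polynomial.X ^ ((Zb α).card + (Wb α).card) else 0
  | Sum.inr (Sum.inl (α, b)) => if α ∈ U ∧ b ∈ Zb α \ α.1 then 1 else 0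
  | Sum.inr (Sum.inr (α, e)) => if α ∈ U ∧ e ∈ Wb α \ α.2 then 1 else 0

/-- The degeneration as a ring map `ℂ[θ, φ, ψ] → ℂ[λ]`. -/
def degHom (U : Finset (Finset (Fin h) × Finset (Fin h))) (Zb Wb : Finset (Fin h) × Finset (Fin h) → Finset (Fin h)) :
    MvPolynomial (Param h) ℂ →+* Polynomial ℂ :=
  (aeval (degSpec U Zb Wb)).toRingHom

/-- The degeneration on a parameter variable. -/
theorem degHom_X (U : Finset (Finset (Fin h) × Finset (Fin h))) (Zb Wb : Finset (Fin h) × Finset (Fin h) → Finset (Fin h))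
    (v : Param h) : degHom U Zb Wb (X v) = degSpec U Zb Wb v := by
  rw [degHom, AlgHom.toRingHom_eq_coe, RingHom.coe_coe, aeval_X]

/-- The plain brick product `∏_{α ∈ U} (1 + x^{Zb α} y^{Wb α})`. -/
def brickProd (U : Finset (Finset (Fin h) × Finset (Fin h))) (Zb Wb : Finset (Fin h) × Finset (Fin h) → Finset (Fin h)) :
    MvPolynomial (Fin (h + h)) ℂ :=
  ∏ α ∈ U, (1 + monomial (pexpo (Zb α) (Wb α)) 1)

section Factors

variable (U : Finset (Finset (Fin h) × Finset (Fin h))) (Zb Wb : Finset (Fin h) × Finset (Fin h) → Finset (Fin h))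

/-- Unused anchors die. -/
theorem map_degHom_symbFactor_of_not_mem {α : Finset (Fin h) × Finset (Fin h)} (hα : α ∉ U) :
    MvPolynomial.map (degHom U Zb Wb) (symbFactor h α) = 1 := by
  rw [symbFactor]
  simp only [map_add, map_one, map_mul, map_prod, map_C, map_X, degHom_X, degSpec, if_neg hα, map_zero, zero_mul, add_zero]

/-- The twist product of a used anchor: twists outside the brick die, those inside become `1 + X`. -/
theorem prod_twist_deg {A P : Finset (Fin h)} (hP : P ⊆ univ \ A) (c : Prop) [Decidable c] (hc : c) (e : Fin h → Fin (h + h)) :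
    (∏ b ∈ univ \ A, (1 + C (if c ∧ b ∈ P then (1 : Polynomial ℂ) else 0) * X (e b)) :
        MvPolynomial (Fin (h + h)) (Polynomial ℂ)) = ∏ b ∈ P, (1 + X (e b)) := by
  rw [← Finset.prod_subset hP (fun b _ hbP => by
    rw [if_neg (fun h' => hbP h'.2), map_zero, zero_mul, add_zero])]
  exact Finset.prod_congr rfl (fun b hb => by rw [if_pos ⟨hc, hb⟩, map_one, one_mul])

/-- Used anchors: `1 + (λ^{|A|+|B|} x^A y^B) · ∏_{b ∈ Zb∖A} (λ + λ x_b) · ∏_{e ∈ Wb∖B} (λ + λ y_e)`. -/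
theorem map_degHom_symbFactor_of_mem {α : Finset (Fin h) × Finset (Fin h)} (hα : α ∈ U) (hZ : α.1 ⊆ Zb α) (hW : α.2 ⊆ Wb α) :
    MvPolynomial.map (degHom U Zb Wb) (symbFactor h α) =
      1 + (C (Polynomial.X ^ Finsupp.degree (pexpo α.1 α.2)) * monomial (pexpo α.1 α.2) 1) *
        (∏ b ∈ Zb α \ α.1, (C Polynomial.X + C Polynomial.X * X (Fin.castAdd h b))) *
        (∏ e ∈ Wb α \ α.2, (C Polynomial.X + C Polynomial.X * X (Fin.natAdd h e))) := by
  classical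
  have hP : Zb α \ α.1 ⊆ univ \ α.1 := Finset.sdiff_subset_sdiff (Finset.subset_univ _) subset_rfl
  have hQ : Wb α \ α.2 ⊆ univ \ α.2 := Finset.sdiff_subset_sdiff (Finset.subset_univ _) subset_rfl
  rw [symbFactor]
  simp only [map_add, map_one, map_mul, map_prod, map_C, map_X, degHom_X, degSpec, if_pos hα]
  rw [prod_twist_deg hP (α ∈ U) hα, prod_twist_deg hQ (α ∈ U) hα, degree_pexpo,
    prod_X_eq_monomial', prod_X_eq_monomial',
    show ((Zb α).card + (Wb α).card) = (α.1.card + α.2.card) + (Zb α \ α.1).card + (Wb α \ α.2).card by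
      rw [Finset.card_sdiff_of_subset hZ, Finset.card_sdiff_of_subset hW]
      have h1 := Finset.card_le_card hZ; have h2 := Finset.card_le_card hW; omega,
    pow_add, pow_add, map_mul, map_mul]
  have hx : ∏ b ∈ Zb α \ α.1, (C Polynomial.X + C Polynomial.X * X (Fin.castAdd h b) :
      MvPolynomial (Fin (h + h)) (Polynomial ℂ)) =
      C (Polynomial.X ^ (Zb α \ α.1).card) * ∏ b ∈ Zb α \ α.1, (1 + X (Fin.castAdd h b)) := by
    rw [map_pow, ← Finset.prod_const, ← Finset.prod_mul_distrib]
    exact Finset.prod_congr rfl (fun b _ => by ring)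
  have hy : ∏ e ∈ Wb α \ α.2, (C Polynomial.X + C Polynomial.X * X (Fin.natAdd h e) :
      MvPolynomial (Fin (h + h)) (Polynomial ℂ)) =
      C (Polynomial.X ^ (Wb α \ α.2).card) * ∏ e ∈ Wb α \ α.2, (1 + X (Fin.natAdd h e)) := by
    rw [map_pow, ← Finset.prod_const, ← Finset.prod_mul_distrib]
    exact Finset.prod_congr rfl (fun e _ => by ring)
  rw [hx, hy, pexpo_def,
    show monomial ((∑ a ∈ α.1, Finsupp.single (Fin.castAdd h a) 1) + ∑ c ∈ α.2, Finsupp.single (Fin.natAdd h c) 1)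
        (1 : Polynomial ℂ) =
      monomial (∑ a ∈ α.1, Finsupp.single (Fin.castAdd h a) 1) 1 *
        monomial (∑ c ∈ α.2, Finsupp.single (Fin.natAdd h c) 1) 1 by rw [monomial_mul, mul_one]]
  ring

/-- Lowest-order part of a used factor: the FULL brick. -/
theorem lowPart_symbFactor_of_mem {α : Finset (Fin h) × Finset (Fin h)} (hα : α ∈ U) (hZ : α.1 ⊆ Zb α) (hW : α.2 ⊆ Wb α) :
    LowPart (MvPolynomial.map (degHom U Zb Wb) (symbFactor h α)) (1 + monomial (pexpo (Zb α) (Wb α)) 1) := by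
  classical
  rw [map_degHom_symbFactor_of_mem U Zb Wb hα hZ hW]
  refine LowPart.add LowPart.one ?_
  have hb : monomial (pexpo (Zb α) (Wb α)) (1 : ℂ) = monomial (pexpo α.1 α.2) 1 *
      (∏ b ∈ Zb α \ α.1, X (Fin.castAdd h b)) * (∏ e ∈ Wb α \ α.2, X (Fin.natAdd h e)) := by
    rw [prod_X_eq_monomial', prod_X_eq_monomial', monomial_mul, monomial_mul, mul_one, mul_one, add_assoc, ← pexpo_def,
      ← pexpo_union (Finset.disjoint_sdiff) (Finset.disjoint_sdiff), Finset.union_sdiff_of_subset hZ,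
      Finset.union_sdiff_of_subset hW]
  rw [hb]
  exact LowPart.mul (LowPart.mul (LowPart.monomial _) (LowPart.prod _ (fun b _ => LowPart.lin _)))
    (LowPart.prod _ (fun e _ => LowPart.lin _))

/-- **Lowest-order part of the degenerated symbolic witness = the plain brick product.** -/
theorem lowPart_symbolicWitness (s h : ℕ) (U : Finset (Finset (Fin h) × Finset (Fin h)))
    (Zb Wb : Finset (Fin h) × Finset (Fin h) → Finset (Fin h)) (hU : U ⊆ anchors s h)
    (hZ : ∀ α ∈ U, α.1 ⊆ Zb α) (hW : ∀ α ∈ U, α.2 ⊆ Wb α) :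
    LowPart (MvPolynomial.map (degHom U Zb Wb) (symbolicWitness s h)) (brickProd U Zb Wb) := by
  classical
  rw [symbolicWitness_eq_prod, map_prod, brickProd, ← Finset.prod_filter_mul_prod_filter_not (anchors s h) (· ∈ U),
    Finset.filter_mem_eq_inter, Finset.inter_eq_right.mpr hU]
  have h2 : ∏ α ∈ (anchors s h).filter (fun α => ¬ α ∈ U), MvPolynomial.map (degHom U Zb Wb) (symbFactor h α) = 1 :=
    Finset.prod_eq_one (fun α hα => map_degHom_symbFactor_of_not_mem U Zb Wb (Finset.mem_filter.mp hα).2)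
  rw [h2, mul_one]
  exact LowPart.prod U (fun α hα => lowPart_symbFactor_of_mem U Zb Wb hα (hZ α hα) (hW α hα))

end Factors

/-! ## 3. The determinant -/

/-- **Brick degeneration.** A brick list with distinct anchor representatives whose plain layout on `(u, w)` is nonsingular makes the
symbolic minor of the anchored door nonzero. -/
theorem symbolicDet_ne_zero_of_brickDegeneration (s h r : ℕ) (u w : Fin r → Finset (Fin h))
    (U : Finset (Finset (Fin h) × Finset (Fin h))) (Zb Wb : Finset (Fin h) × Finset (Fin h) → Finset (Fin h))
    (hU : U ⊆ anchors s h) (hZ : ∀ α ∈ U, α.1 ⊆ Zb α) (hW : ∀ α ∈ U, α.2 ⊆ Wb α)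
    (hdet : (Matrix.of fun i j : Fin r => coeff (pexpo (u i) (w j)) (brickProd U Zb Wb)).det ≠ 0) :
    symbolicDet s h r u w ≠ 0 := by
  classical
  have hlow := lowPart_symbolicWitness s h U Zb Wb hU hZ hW
  -- the degenerated layout matrix and its divisibility by the row/column powers of λ
  obtain ⟨L', hL'⟩ : ∃ L' : Matrix (Fin r) (Fin r) (Polynomial ℂ),
      L' = Matrix.of fun i j : Fin r => coeff (pexpo (u i) (w j)) (MvPolynomial.map (degHom U Zb Wb) (symbolicWitness s h)) :=
    ⟨_, rfl⟩
  have hdvd : ∀ i j, ∃ q : Polynomial ℂ, L' i j = Polynomial.X ^ ((u i).card + (w j).card) * q ∧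
      q.coeff 0 = coeff (pexpo (u i) (w j)) (brickProd U Zb Wb) := by
    intro i j
    obtain ⟨hlt, heq⟩ := hlow (pexpo (u i) (w j))
    rw [degree_pexpo] at hlt heq
    have hx : Polynomial.X ^ ((u i).card + (w j).card) ∣ L' i j := by
      rw [Polynomial.X_pow_dvd_iff]
      intro d hd
      rw [hL', Matrix.of_apply]
      exact hlt d hd
    obtain ⟨q, hq⟩ := hx
    refine ⟨q, hq, ?_⟩
    have := heq
    rw [← Matrix.of_apply (fun i j : Fin r => coeff (pexpo (u i) (w j))
      (MvPolynomial.map (degHom U Zb Wb) (symbolicWitness s h))) i j, ← hL', hq,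
      Polynomial.coeff_X_pow_mul', if_pos le_rfl, Nat.sub_self] at this
    exact this
  choose M hM hM0 using hdvd
  have hfac : L' = Matrix.of fun i j : Fin r => Polynomial.X ^ (u i).card * (Polynomial.X ^ (w j).card * M i j) := by
    funext i j
    rw [hM i j, Matrix.of_apply, pow_add, mul_assoc]
  have hdetL' : L'.det = (∏ i, Polynomial.X ^ (u i).card) * ((∏ j, Polynomial.X ^ (w j).card) *
      (Matrix.of fun i j : Fin r => M i j).det) := by
    have e1 : (Matrix.of fun i j : Fin r => Polynomial.X ^ (u i).card * (Polynomial.X ^ (w j).card * M i j)) =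
        Matrix.of fun i j : Fin r => (fun i => Polynomial.X ^ (u i).card) i *
          (Matrix.of fun i j : Fin r => Polynomial.X ^ (w j).card * M i j) i j := rfl
    have e2 : (Matrix.of fun i j : Fin r => Polynomial.X ^ (w j).card * M i j) =
        Matrix.of fun i j : Fin r => (fun j => Polynomial.X ^ (w j).card) j * (Matrix.of fun i j : Fin r => M i j) i j := rfl
    rw [hfac, e1, Matrix.det_mul_column, e2, Matrix.det_mul_row]
  -- the degenerated determinant is the image of the symbolic one
  have hmap : L'.det = degHom U Zb Wb (symbolicDet s h r u w) := by
    have h1 : symbolicDet s h r u w =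
        (Matrix.of fun i j : Fin r => coeff (pexpo (u i) (w j)) (symbolicWitness s h)).det := rfl
    have h2 : L' = (degHom U Zb Wb).mapMatrix
        (Matrix.of fun i j : Fin r => coeff (pexpo (u i) (w j)) (symbolicWitness s h)) := by
      rw [hL']
      ext i j
      rw [RingHom.mapMatrix_apply, Matrix.map_apply, Matrix.of_apply, Matrix.of_apply, coeff_map]
    rw [h1, RingHom.map_det, h2]
  -- constant coefficient of det M is det of the brick layout
  have hconst : Polynomial.constantCoeff ((Matrix.of fun i j : Fin r => M i j).det) =
      (Matrix.of fun i j : Fin r => coeff (pexpo (u i) (w j)) (brickProd U Zb Wb)).det := by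
    rw [RingHom.map_det]
    congr 1
    ext i j
    rw [RingHom.mapMatrix_apply, Matrix.map_apply, Matrix.of_apply, Matrix.of_apply, Polynomial.constantCoeff_apply, hM0]
  intro hzero
  have hL0 : L'.det = 0 := by rw [hmap, hzero, map_zero]
  rw [hdetL'] at hL0
  have hM' : (Matrix.of fun i j : Fin r => M i j).det = 0 := by
    have hX : (∏ i, (Polynomial.X : Polynomial ℂ) ^ (u i).card) ≠ 0 :=
      Finset.prod_ne_zero_iff.mpr (fun i _ => pow_ne_zero _ Polynomial.X_ne_zero)
    have hY : (∏ j, (Polynomial.X : Polynomial ℂ) ^ (w j).card) ≠ 0 :=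
      Finset.prod_ne_zero_iff.mpr (fun j _ => pow_ne_zero _ Polynomial.X_ne_zero)
    rcases mul_eq_zero.mp hL0 with h0 | h0
    · exact absurd h0 hX
    · rcases mul_eq_zero.mp h0 with h0' | h0'
      · exact absurd h0' hY
      · exact h0'
  apply hdet
  rw [← hconst, hM', map_zero]

end

end Summit.ValiantsHypothesis.ValiantsHypothesis.Theorems.BarrierLever.AnchoredPeeling
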